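import Summits.CriticalPhenomena.Ising3D.TaylorTableHeadPartsL
import HarnessLib

/-!
# The TABLE layer of a derivative certificate, XXXVI: part checks and finals depend on the δ-rows only through the rows a slice reads
(cell `pub-ising3x`, seat boot-1 gen 10; gate (g2) — replay layout: BLANKED row literals per file)

HONEST FRAMING: lottery ticket; floor = tightest certified 3D Ising CFT bounds; no exact-solution
claim without a proof. Island framing: certified exclusion region at stated derivative order and
assumptions; not a determination of the 3D Ising critical exponents beyond that.

A replay file carries the δ-row literals `L` BLANKED to the rows `j` its parts read (the full odd rows are ≈ 370 KB, a file may hold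
≤ 512 KB; HEAD-DELTA.md §8.4–8.5), and the cell's FINAL file carries no rows at all. The landed soundness theorems speak about ONE row object
`R` whose validity `R.ValidΔ …` is established (the region layer's data); this file proves that the checks evaluated on a blanked copy `R'`
EQUAL the checks on `R`: `headPolyTM` reads `rows.getD j []` only for `j ∈ {q.2 : q ∈ slice}` (`headPolyTM_congr_rows`); the odd part check
reads `R.rows c m` at those `j`, i.e. `R.lit j` (`oddPartOKL_congr_rows`); the even part check reads `R.L.getD j` (`evenPartOKL_congr_rows`);
and the two finals read only the scalar fields `S, J, Wσ, Wε` (`oddHeadFinalOKΔM_congr_rows`, `evenHeadPartsFinalOKΔ_congr_rows`).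
Elementary (list induction / unfolding). [folklore]
-/

namespace Summit.CriticalPhenomena.Ising3D

open Literature.Analysis.ValidatedNumerics Literature.Analysis.ValidatedNumerics.PolyMP
open Literature.Analysis.ValidatedNumerics.NumericsMP (MI)
open Literature.MathematicalPhysics.QuantumFieldTheory.ConformalBootstrap3D
open Literature.MathematicalPhysics.QuantumFieldTheory.ConformalBootstrap3D.HRTM (rowEntry pivOK)

/-- **`headPolyTM` depends on the rows only through the positions `q.2` of its slice.** [folklore] -/
theorem headPolyTM_congr_rows (S : ℕ) {rows rows' : List IPoly} (tms : List (List IPoly)) (nF ℓ : ℕ) (ctr : ℚ) :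
    ∀ sl : List (ℕ × ℕ), (∀ q ∈ sl, rows.getD q.2 [] = rows'.getD q.2 []) →
      headPolyTM S rows tms nF ℓ ctr sl = headPolyTM S rows' tms nF ℓ ctr sl
  | [], _ => rfl
  | q :: qs, h => by
      simp only [headPolyTM]
      rw [h q List.mem_cons_self, headPolyTM_congr_rows S tms nF ℓ ctr qs fun q' hq' => h q' (List.mem_cons_of_mem _ hq')]

/-! ### Odd sector -/

/-- Two odd row objects AGREE on a slice: same scale and the same row literal at every `j` the slice reads. [folklore] -/
def OddRowsAgreeOn (R R' : OddHeadRowsΔ) (sl : List (ℕ × ℕ)) : Prop :=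
  R.S = R'.S ∧ ∀ q ∈ sl, R.lit q.2 = R'.lit q.2

/-- Agreement of the projected row lists at the read positions. [folklore] -/
theorem OddRowsAgreeOn.rows_getD {R R' : OddHeadRowsΔ} {sl : List (ℕ × ℕ)} (h : OddRowsAgreeOn R R' sl) (c m : ℕ) :
    ∀ q ∈ sl, (R.rows c m).getD q.2 [] = (R'.rows c m).getD q.2 [] := by
  intro q hq
  rw [R.getD_rows, R'.getD_rows, h.2 q hq]

/-- **The odd literal-table part check is invariant under replacing the rows by ones agreeing on the part's slice** (blanked rows).
[folklore] -/
theorem oddPartOKL_congr_rows {R R' : OddHeadRowsΔ} (C : EvenCellTM) (tS tP tM : List (List IPoly)) (p : HeadPartOdd)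
    (h : OddRowsAgreeOn R R' ((C.F.drop p.t0).take p.count)) : oddPartOKL R C tS tP tM p = oddPartOKL R' C tS tP tM p := by
  have hr := h.rows_getD
  simp only [oddPartOKL, famTriple, h.1, headPolyTM_congr_rows R'.S tS C.nF C.ℓ C.ctr _ (hr 0 0),
    headPolyTM_congr_rows R'.S tS C.nF C.ℓ C.ctr _ (hr 0 1), headPolyTM_congr_rows R'.S tS C.nF C.ℓ C.ctr _ (hr 0 2),
    headPolyTM_congr_rows R'.S tP C.nF C.ℓ C.ctr _ (hr 1 0), headPolyTM_congr_rows R'.S tP C.nF C.ℓ C.ctr _ (hr 1 1),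
    headPolyTM_congr_rows R'.S tP C.nF C.ℓ C.ctr _ (hr 1 2), headPolyTM_congr_rows R'.S tP C.nF C.ℓ C.ctr _ (hr 2 0),
    headPolyTM_congr_rows R'.S tP C.nF C.ℓ C.ctr _ (hr 2 1), headPolyTM_congr_rows R'.S tP C.nF C.ℓ C.ctr _ (hr 2 2),
    headPolyTM_congr_rows R'.S tM C.nF C.ℓ C.ctr _ (hr 3 0), headPolyTM_congr_rows R'.S tP C.nF C.ℓ C.ctr _ (hr 4 0),
    headPolyTM_congr_rows R'.S tP C.nF C.ℓ C.ctr _ (hr 4 1), headPolyTM_congr_rows R'.S tP C.nF C.ℓ C.ctr _ (hr 4 2)]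

/-- **The merged odd final reads no rows**: it depends on `R` only through `S, J, Wσ, Wε`. [folklore] -/
theorem oddHeadFinalOKΔM_congr_rows {R R' : OddHeadRowsΔ} (hS : R.S = R'.S) (hJ : R.J = R'.J)
    (hWσ : R.Wσ = R'.Wσ) (hWε : R.Wε = R'.Wε) (dP : ℕ) (C : EvenCellTM) (t₁ t₂ : ℚ) (K Mσ Mε : MI) (κ₀ : ℚ)
    (ps : List HeadPartOdd) : oddHeadFinalOKΔM R dP C t₁ t₂ K Mσ Mε κ₀ ps = oddHeadFinalOKΔM R' dP C t₁ t₂ K Mσ Mε κ₀ ps := by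
  have hb : R.Wb = R'.Wb := by rw [OddHeadRowsΔ.Wb, OddHeadRowsΔ.Wb, hWσ, hWε]
  have ht : R.Wt = R'.Wt := by rw [OddHeadRowsΔ.Wt, OddHeadRowsΔ.Wt, hWσ, hWε]
  simp only [oddHeadFinalOKΔM, oddHeadStructOK, hS, hJ, hb, ht, hWσ]

/-! ### Even sector -/

/-- The blank even row entry (all nine lists empty). [folklore] -/
def blankEvenLit : ITriple × ITriple × ITriple := (([], [], []), ([], [], []), ([], [], []))

/-- Two even row objects AGREE on a slice: same scale, same `J`, and the same row literal at every `j` the slice reads. [folklore] -/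
def EvenRowsAgreeOn (R R' : HeadRowsΔ) (sl : List (ℕ × ℕ)) : Prop :=
  R.S = R'.S ∧ R.J = R'.J ∧ ∀ q ∈ sl, R.L.getD q.2 blankEvenLit = R'.L.getD q.2 blankEvenLit

/-- Reading a projected even row list off the literal list. [folklore] -/
theorem HeadRowsΔ.getD_map_proj (R : HeadRowsΔ) (f : ITriple × ITriple × ITriple → IPoly) (hf : f blankEvenLit = []) (j : ℕ) :
    (R.L.map f).getD j [] = f (R.L.getD j blankEvenLit) := by
  rw [← hf, List.getD_map]

/-- `headPartOKWith` on one order view is invariant under rows agreeing on the slice (the nine projections). [folklore] -/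
theorem headPartOKWith_congr_rows {R R' : HeadRowsΔ} (tms : List (List IPoly)) (C : EvenCellTM) (pm : HeadPart)
    (h : EvenRowsAgreeOn R R' (pm.slice C.F)) :
    headPartOKWith tms R.rows0 C pm = headPartOKWith tms R'.rows0 C pm ∧
      headPartOKWith tms R.rows1 C pm = headPartOKWith tms R'.rows1 C pm ∧
      headPartOKWith tms R.rows2 C pm = headPartOKWith tms R'.rows2 C pm := by
  obtain ⟨hS, _, hL⟩ := h
  have key : ∀ (f : ITriple × ITriple × ITriple → IPoly), f blankEvenLit = [] →
      ∀ q ∈ pm.slice C.F, (R.L.map f).getD q.2 [] = (R'.L.map f).getD q.2 [] := by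
    intro f hf q hq
    rw [R.getD_map_proj f hf, R'.getD_map_proj f hf, hL q hq]
  refine ⟨?_, ?_, ?_⟩ <;>
    simp only [headPartOKWith, HeadRowsΔ.rows0, HeadRowsΔ.rows1, HeadRowsΔ.rows2, HeadRowsΔ.RX0, HeadRowsΔ.RX1, HeadRowsΔ.RX2,
      HeadRowsΔ.RY0, HeadRowsΔ.RY1, HeadRowsΔ.RY2, HeadRowsΔ.RZ0, HeadRowsΔ.RZ1, HeadRowsΔ.RZ2, hS,
      headPolyTM_congr_rows R'.S tms C.nF C.ℓ C.ctr _ (key (fun t => t.1.1) rfl),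
      headPolyTM_congr_rows R'.S tms C.nF C.ℓ C.ctr _ (key (fun t => t.1.2.1) rfl),
      headPolyTM_congr_rows R'.S tms C.nF C.ℓ C.ctr _ (key (fun t => t.1.2.2) rfl),
      headPolyTM_congr_rows R'.S tms C.nF C.ℓ C.ctr _ (key (fun t => t.2.1.1) rfl),
      headPolyTM_congr_rows R'.S tms C.nF C.ℓ C.ctr _ (key (fun t => t.2.1.2.1) rfl),
      headPolyTM_congr_rows R'.S tms C.nF C.ℓ C.ctr _ (key (fun t => t.2.1.2.2) rfl),
      headPolyTM_congr_rows R'.S tms C.nF C.ℓ C.ctr _ (key (fun t => t.2.2.1) rfl),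
      headPolyTM_congr_rows R'.S tms C.nF C.ℓ C.ctr _ (key (fun t => t.2.2.2.1) rfl),
      headPolyTM_congr_rows R'.S tms C.nF C.ℓ C.ctr _ (key (fun t => t.2.2.2.2) rfl)]

/-- **The even literal-table part check is invariant under replacing the rows by ones agreeing on the part's slice.** [folklore] -/
theorem evenPartOKL_congr_rows {R R' : HeadRowsΔ} (C : EvenCellTM) (tms : List (List IPoly)) (p : HeadPart3)
    (h : EvenRowsAgreeOn R R' ((C.F.drop p.t0).take p.count)) : evenPartOKL R C tms p = evenPartOKL R' C tms p := by
  have h0 : EvenRowsAgreeOn R R' (p.ord0.slice C.F) := h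
  have h1 : EvenRowsAgreeOn R R' (p.ord1.slice C.F) := h
  have h2 : EvenRowsAgreeOn R R' (p.ord2.slice C.F) := h
  obtain ⟨a0, -, -⟩ := headPartOKWith_congr_rows tms C p.ord0 h0
  obtain ⟨-, b1, -⟩ := headPartOKWith_congr_rows tms C p.ord1 h1
  obtain ⟨-, -, c2⟩ := headPartOKWith_congr_rows tms C p.ord2 h2
  simp only [evenPartOKL, a0, b1, c2]

/-- **The even final reads no rows**: it depends on `R` only through `S, J, Wσ, Wε`. [folklore] -/
theorem evenHeadPartsFinalOKΔ_congr_rows {R R' : HeadRowsΔ} (hS : R.S = R'.S) (hJ : R.J = R'.J) (hWσ : R.Wσ = R'.Wσ)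
    (hWε : R.Wε = R'.Wε) (dP : ℕ) (C : EvenCellTM) (ps : List HeadPart3) :
    evenHeadPartsFinalOKΔ R dP C ps = evenHeadPartsFinalOKΔ R' dP C ps := by
  have hb : R.Wb = R'.Wb := by rw [HeadRowsΔ.Wb, HeadRowsΔ.Wb, hWσ, hWε]
  simp only [evenHeadPartsFinalOKΔ, hS, hJ, hWσ, hWε, hb]

end Summit.CriticalPhenomena.Ising3D
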